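import Summits.RiemannHypothesis.RiemannHypothesis.Theorems.EtaLeadingQuarterWeakLockingLayerConstruction
import Summits.RiemannHypothesis.RiemannHypothesis.Theorems.EtaLeadingQuarterWeakLockingLayerZeroSideMid
import Literature.NumberTheory.LFunctions.ZetaArgBacklundExplicit

/-!
# The weak locking layer, II: the estimates at a fixed large `M`
(route EtaLeadingQuarter, item `WeakLockingLayer`, stmt-RiemannHypothesis-21792)

For the explicit layer of `EtaLeadingQuarterWeakLockingLayerConstruction.lean` and every `M` with
`log M ≥ 150` (writing `L = log M`, `s = s_M = √(L/150)`, `D = D_M`):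

* `mass_ge` — `D ≥ √(2π) s e^{271L/300} − e^{L/4} − 1 − 2√π` (engine, `γ = 0`), hence `D ≥ s e^{271L/300}`;
* `norm_coeffPoly_le` — at height `|γ| > 14`:
  `‖D_c(γ)‖ ≤ ((√(2π)s + 1) e^{L/4} + 1 + 2√π) + √(2π) s |γ|` (engine; `s²γ² ≥ (196/150) L`);
* `zeroSide_le` — the three-range bound for `∑'_ρ m γ^{-2} ‖D_c(γ)‖²` with `X = e^{37L/50}`,
  `T₂ = e^{6L/5}` (parts I/II of the zero-side files and the tree's explicit `N(T)`).

Part III turns these into the limit. Nothing here bears on the truth of RH.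
-/

noncomputable section

open Complex MeasureTheory Set Filter Finset intervalIntegral
open scoped Real Topology ComplexConjugate

set_option linter.dupNamespace false  -- the mandated namespace repeats `RiemannHypothesis`

namespace Summit.RiemannHypothesis.RiemannHypothesis.Theorems.EtaLeadingQuarter.Locking

open Literature.NumberTheory.LFunctions NicolasJExplicit SchoenfeldBound ZetaZeroTails
open Summit.RiemannHypothesis.RiemannHypothesis.Theorems.EtaLeadingQuarter.LockingEngine
open Summit.RiemannHypothesis.RiemannHypothesis.Theorems.EtaLeadingQuarter.ZeroSide

/-! ## Numerical constants -/

/-- `2 ≤ √(2π) ≤ 3` and `√π ≤ 2`. [folklore] -/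
theorem sqrt_two_pi_bounds : 2 ≤ Real.sqrt (2 * π) ∧ Real.sqrt (2 * π) ≤ 3 ∧ Real.sqrt π ≤ 2 := by
  have hπ1 := Real.pi_gt_three
  have hπ2 := Real.pi_lt_four
  refine ⟨?_, ?_, ?_⟩
  · calc (2 : ℝ) = Real.sqrt (2 ^ 2) := (Real.sqrt_sq (by norm_num)).symm
      _ ≤ Real.sqrt (2 * π) := Real.sqrt_le_sqrt (by nlinarith)
  · calc Real.sqrt (2 * π) ≤ Real.sqrt (3 ^ 2) := Real.sqrt_le_sqrt (by nlinarith)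
      _ = 3 := Real.sqrt_sq (by norm_num)
  · calc Real.sqrt π ≤ Real.sqrt (2 ^ 2) := Real.sqrt_le_sqrt (by nlinarith)
      _ = 2 := Real.sqrt_sq (by norm_num)

/-- `2516 ≤ e^8` (`e > 2.7`). [folklore] -/
theorem exp_eight_ge : (2516 : ℝ) ≤ Real.exp 8 := by
  have h := Real.exp_one_gt_d9
  have h8 : Real.exp 1 ^ 8 = Real.exp 8 := by rw [Real.exp_one_pow 8]; norm_num
  rw [← h8]
  have h27 : (2.7 : ℝ) ≤ Real.exp 1 := by linarith
  calc (2516 : ℝ) ≤ 2.7 ^ 8 := by norm_num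
    _ ≤ Real.exp 1 ^ 8 := pow_le_pow_left₀ (by norm_num) h27 8

/-! ## The width at large `M` -/

/-- `s_M² = L/150` (`L = log M ≥ 0`). [folklore] -/
theorem width_sq (M : ℕ) : width M ^ 2 = Real.log M / 150 :=
  Real.sq_sqrt (div_nonneg (Real.log_natCast_nonneg M) (by norm_num))

/-- `1 ≤ s_M` once `log M ≥ 150`. [folklore] -/
theorem one_le_width {M : ℕ} (hL : 150 ≤ Real.log M) : 1 ≤ width M := by
  rw [width, ← Real.sqrt_one]
  exact Real.sqrt_le_sqrt (by rw [le_div_iff₀ (by norm_num)]; linarith)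

/-! ## The mass from below -/

/-- **`D_M ≥ √(2π) s e^{271L/300} − e^{L/4} − 1 − 2√π`** for `log M ≥ 150`. [folklore] -/
theorem mass_ge {M : ℕ} (hL : 150 ≤ Real.log M) :
    Real.sqrt (2 * π) * width M * Real.exp (271 / 300 * Real.log M) - Real.exp (Real.log M / 4) - 1 -
        2 * Real.sqrt π ≤ mass M := by
  have hs1 := one_le_width hL
  have hs : 0 < width M := by linarith
  have hs2 := width_sq M
  have hM1 : 1 ≤ M := by
    by_contra h
    rw [not_le] at h
    interval_cases M
    simp at hL; linarith
  have hU : 2 * width M ^ 2 ≤ Real.log M - center M := by rw [hs2, center]; linarith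
  have h := sum_gauss_ge hs (center M) hM1 hU
  have e1 : Real.sqrt (2 * π * width M ^ 2) = Real.sqrt (2 * π) * width M := by
    rw [Real.sqrt_mul (by positivity), Real.sqrt_sq hs.le]
  have e2 : center M + width M ^ 2 / 2 = 271 / 300 * Real.log M := by rw [hs2, center]; ring
  have e3 : center M + (Real.log M - center M) - (Real.log M - center M) ^ 2 / (2 * width M ^ 2) =
      Real.log M / 4 := by
    rw [hs2, center]
    have hL0 : Real.log M ≠ 0 := by linarith
    field_simp
    ring
  rw [e1, e2, e3] at h
  exact h

/-- **`D_M ≥ s e^{271L/300} > 0`** for `log M ≥ 150` (absorbing the lower-order terms: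
`(√(2π) − 1) s e^{271L/300} ≥ e^{L/4} + 1 + 2√π`). [folklore] -/
theorem mass_ge' {M : ℕ} (hL : 150 ≤ Real.log M) :
    width M * Real.exp (271 / 300 * Real.log M) ≤ mass M := by
  have h := mass_ge hL
  obtain ⟨h2π, -, hπ⟩ := sqrt_two_pi_bounds
  have hs1 := one_le_width hL
  set E := Real.exp (271 / 300 * Real.log M) with hEdef
  have hE0 : 0 ≤ E := (Real.exp_pos _).le
  have hE10 : (10 : ℝ) ≤ E := by
    have := Real.add_one_le_exp (271 / 300 * Real.log M)
    rw [hEdef]; linarith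
  have hE2 : 2 * Real.exp (Real.log M / 4) ≤ E := by
    have h1 : (2 : ℝ) ≤ Real.exp (196 / 300 * Real.log M) := by
      have := Real.add_one_le_exp (196 / 300 * Real.log M); linarith
    have h2 : Real.exp (Real.log M / 4) * Real.exp (196 / 300 * Real.log M) = E := by
      rw [hEdef, ← Real.exp_add]; ring_nf
    nlinarith [Real.exp_pos (Real.log M / 4)]
  have hsE : 0 ≤ width M * E := by positivity
  have h1 : 2 * (width M * E) ≤ Real.sqrt (2 * π) * width M * E := by nlinarith
  have h2 : E ≤ width M * E := le_mul_of_one_le_left hE0 hs1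
  linarith

/-- `0 < D_M` for `log M ≥ 150`. [folklore] -/
theorem mass_pos' {M : ℕ} (hL : 150 ≤ Real.log M) : 0 < mass M :=
  lt_of_lt_of_le (mul_pos (by linarith [one_le_width hL]) (Real.exp_pos _)) (mass_ge' hL)

/-! ## The coefficient polynomial at the zeros -/

/-- **Pointwise bound at height `|γ| > 14`** (`log M ≥ 150`):
`‖D_c(γ)‖ ≤ ((√(2π)s + 1) e^{L/4} + 1 + 2√π) + √(2π) s |γ|`. [folklore] -/
theorem norm_coeffPoly_le {M : ℕ} (hL : 150 ≤ Real.log M) {γ : ℝ} (hγ : 14 < |γ|) :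
    ‖dirPoly (coeff M) M γ‖ ≤
      ((Real.sqrt (2 * π) * width M + 1) * Real.exp (Real.log M / 4) + 1 + 2 * Real.sqrt π) +
        Real.sqrt (2 * π) * width M * |γ| := by
  have hs1 := one_le_width hL
  have hs : 0 < width M := by linarith
  have hs2 := width_sq M
  have hM1 : 1 ≤ M := by
    by_contra h
    rw [not_le] at h
    interval_cases M
    simp at hL; linarith
  have hU : 2 * width M ^ 2 ≤ Real.log M - center M := by rw [hs2, center]; linarith
  have h := norm_sum_gauss_cpow_le hs (center M) γ hM1 hU
  have e1 : Real.sqrt (2 * π * width M ^ 2) = Real.sqrt (2 * π) * width M := by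
    rw [Real.sqrt_mul (by positivity), Real.sqrt_sq hs.le]
  have e3 : center M + (Real.log M - center M) - (Real.log M - center M) ^ 2 / (2 * width M ^ 2) =
      Real.log M / 4 := by
    rw [hs2, center]
    have hL0 : Real.log M ≠ 0 := by linarith
    field_simp
    ring
  -- the Gaussian decay at the zero: `n + (1 - γ²) s²/2 ≤ L/4`
  have hγ2 : 196 < γ ^ 2 := by
    rw [← sq_abs]; nlinarith [abs_nonneg γ]
  have e2 : Real.exp (center M + (1 - γ ^ 2) * width M ^ 2 / 2) ≤ Real.exp (Real.log M / 4) := by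
    rw [Real.exp_le_exp, hs2, center]
    nlinarith
  have hsum : ∑ m ∈ Finset.Icc 2 M, ((Real.exp (-((Real.log m - center M) ^ 2 / (2 * width M ^ 2))) : ℝ) : ℂ) *
      (m : ℂ) ^ (((γ : ℝ) : ℂ) * I) = dirPoly (coeff M) M (-γ) := sum_bump_cpow_eq M γ
  rw [hsum, norm_dirPoly_neg, e1, e3] at h
  have hK : 0 ≤ Real.sqrt (2 * π) * width M := by positivity
  have := mul_le_mul_of_nonneg_left e2 hK
  linarith

/-! ## The zero side at a fixed large `M` -/

/-- `N(X) ≤ 9 L X` for `X = e^{37L/50}`, `L ≥ 150` (from the tree's explicit Riemann–von Mangoldt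
bound `abs_zetaZeroCount_sub_main_le_explicit'`). [folklore] -/
theorem zetaZeroCount_X_le {L : ℝ} (hL : 150 ≤ L) :
    (zetaZeroCount (Real.exp (37 / 50 * L)) : ℝ) ≤ 9 * L * Real.exp (37 / 50 * L) := by
  set X := Real.exp (37 / 50 * L) with hX
  have hX0 : 0 < X := Real.exp_pos _
  have hX1 : 1 ≤ X := by rw [hX]; exact Real.one_le_exp (by linarith)
  have hXe : Real.exp 1 ≤ X := Real.exp_le_exp.2 (by linarith)
  have h := abs_zetaZeroCount_sub_main_le_explicit' hXe
  rw [abs_le] at h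
  have hlogX : Real.log X = 37 / 50 * L := by rw [hX, Real.log_exp]
  have hπ := Real.pi_gt_three
  have he1 : 1 < 2 * π * Real.exp 1 := by
    have := Real.add_one_le_exp (1 : ℝ); nlinarith
  have hmain : X / (2 * π) * Real.log (X / (2 * π * Real.exp 1)) ≤ X * Real.log X / 6 := by
    have h1 : Real.log (X / (2 * π * Real.exp 1)) ≤ Real.log X := by
      rw [Real.log_div hX0.ne' (by positivity)]
      linarith [Real.log_pos he1]
    have h2 : X / (2 * π) ≤ X / 6 := div_le_div_of_nonneg_left hX0.le (by norm_num) (by linarith)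
    rcases le_or_gt 0 (Real.log (X / (2 * π * Real.exp 1))) with hpos | hneg
    · calc X / (2 * π) * Real.log (X / (2 * π * Real.exp 1)) ≤ X / 6 * Real.log X :=
            mul_le_mul h2 h1 hpos (by positivity)
        _ = X * Real.log X / 6 := by ring
    · have : X / (2 * π) * Real.log (X / (2 * π * Real.exp 1)) ≤ 0 :=
        mul_nonpos_of_nonneg_of_nonpos (by positivity) hneg.le
      have : 0 ≤ X * Real.log X / 6 := by rw [hlogX]; positivity
      linarith
  rw [hlogX] at hmain h
  nlinarith [h.2, hmain, hX1]

/-- **The zero side at a fixed `M` with `log M ≥ 150`.** With `L = log M`, `s = s_M`, `D = D_M`,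
`X = e^{37L/50}`, `T₂ = e^{6L/5}`, `α = (√(2π)s + 1)e^{L/4} + 1 + 2√π`, `β = √(2π) s` and the local
density constant `A` (`N(t+1) − N(t) ≤ A log(t+2)`):
`∑'_ρ m γ^{-2}‖D_c(γ)‖² ≤ 2α² ∑'_ρ m/γ² + 4β²·9LX
   + 2X^{-2}·2A log(T₂+4)·(5(T₂+1)+18M)·(3/2 + L²/2)·D + D²·0.34·(6L/5)/T₂`. [folklore] -/
theorem zeroSide_le {M : ℕ} (hL : 150 ≤ Real.log M) {A : ℝ} (hA0 : 0 ≤ A)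
    (hA : ∀ t : ℝ, 0 ≤ t → (zetaZeroCount (t + 1) : ℝ) - zetaZeroCount t ≤ A * Real.log (t + 2)) :
    ∑' ρ : Zeros, (riemannZetaZeroOrder (ρ : ℂ) : ℝ) / (ρ : ℂ).im ^ 2 * ‖dirPoly (coeff M) M (ρ : ℂ).im‖ ^ 2 ≤
      2 * (((Real.sqrt (2 * π) * width M + 1) * Real.exp (Real.log M / 4) + 1 + 2 * Real.sqrt π)) ^ 2 *
          (∑' ρ : Zeros, (riemannZetaZeroOrder (ρ : ℂ) : ℝ) / (ρ : ℂ).im ^ 2) +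
        4 * (Real.sqrt (2 * π) * width M) ^ 2 * (9 * Real.log M * Real.exp (37 / 50 * Real.log M)) +
      2 * (Real.exp (37 / 50 * Real.log M) ^ 2)⁻¹ * (2 * A * Real.log (Real.exp (6 / 5 * Real.log M) + 4)) *
        ((5 * (Real.exp (6 / 5 * Real.log M) + 1) + 18 * M) * ((3 / 2 + Real.log M ^ 2 / 2) * mass M)) +
      mass M ^ 2 * (0.34 * (6 / 5 * Real.log M) / Real.exp (6 / 5 * Real.log M)) := by
  set L := Real.log M with hLdef
  set X := Real.exp (37 / 50 * L) with hX
  set T₂ := Real.exp (6 / 5 * L) with hT₂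
  set α := (Real.sqrt (2 * π) * width M + 1) * Real.exp (L / 4) + 1 + 2 * Real.sqrt π with hα
  set β := Real.sqrt (2 * π) * width M with hβ
  -- heights
  have hX2 : 2 ≤ X := by
    have := Real.add_one_le_exp (37 / 50 * L); rw [hX]; linarith
  have hXT : X ≤ T₂ := Real.exp_le_exp.2 (by linarith)
  have hT2516 : 2516 ≤ T₂ := exp_eight_ge.trans (Real.exp_le_exp.2 (by linarith))
  -- split
  rw [tsum_eq_sum_add_tail (coeff M) M T₂, ← Finset.sum_sdiff (zerosUpTo_subset hXT)]
  -- the three ranges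
  have hlow := lowRange_le (coeff M) M (X := X) (α := α) (β := β) fun ρ _ ↦
    norm_coeffPoly_le hL (fourteen_lt_abs_im ρ)
  have hmid := midRange_le hA0 hA (coeff M) M hX2 hXT
  have htail := tail_le (coeff M) M hT2516
  rw [sum_abs_coeff] at htail
  have hlogT : Real.log T₂ = 6 / 5 * L := by rw [hT₂, Real.log_exp]
  rw [hlogT] at htail
  -- `S₀ ≤ D`, `N(X) ≤ 9 L X`
  have hS₀ := sum_coeff_sq_le M
  have hNX := zetaZeroCount_X_le hL
  have hmid' : ∑ ρ ∈ zerosUpTo T₂ \ zerosUpTo X,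
      (riemannZetaZeroOrder (ρ : ℂ) : ℝ) / (ρ : ℂ).im ^ 2 * ‖dirPoly (coeff M) M (ρ : ℂ).im‖ ^ 2 ≤
      2 * (X ^ 2)⁻¹ * (2 * A * Real.log (T₂ + 4)) *
        ((5 * (T₂ + 1) + 18 * M) * ((3 / 2 + L ^ 2 / 2) * mass M)) := by
    refine hmid.trans ?_
    have h1 : 0 ≤ 2 * (X ^ 2)⁻¹ * (2 * A * Real.log (T₂ + 4)) := by
      have : 0 ≤ Real.log (T₂ + 4) := Real.log_nonneg (by linarith)
      positivity
    have h2 : 0 ≤ (5 * (T₂ + 1) + 18 * (M : ℝ)) := by positivity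
    have h3 : 0 ≤ 3 / 2 + L ^ 2 / 2 := by positivity
    exact mul_le_mul_of_nonneg_left (mul_le_mul_of_nonneg_left
      (mul_le_mul_of_nonneg_left hS₀ h3) h2) h1
  have hlow' : ∑ ρ ∈ zerosUpTo X,
      (riemannZetaZeroOrder (ρ : ℂ) : ℝ) / (ρ : ℂ).im ^ 2 * ‖dirPoly (coeff M) M (ρ : ℂ).im‖ ^ 2 ≤
      2 * α ^ 2 * (∑' ρ : Zeros, (riemannZetaZeroOrder (ρ : ℂ) : ℝ) / (ρ : ℂ).im ^ 2) +
        4 * β ^ 2 * (9 * L * X) := by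
    refine hlow.trans ?_
    have : 4 * β ^ 2 * (zetaZeroCount X : ℝ) ≤ 4 * β ^ 2 * (9 * L * X) :=
      mul_le_mul_of_nonneg_left hNX (by positivity)
    linarith
  linarith

end Summit.RiemannHypothesis.RiemannHypothesis.Theorems.EtaLeadingQuarter.Locking

end
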